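import Summits.SmoothPoincare4.SmoothPoincare4.Theorems.CylinderEntropyCylinderRungTwoKillingFluxDefs
import Summits.SmoothPoincare4.SmoothPoincare4.Theorems.CylinderEntropyCylinderRungTwoFirstVariationBound
import Summits.SmoothPoincare4.SmoothPoincare4.Theorems.CylinderEntropyCylinderRungTwoLimitMeasureExists
import Summits.SmoothPoincare4.SmoothPoincare4.Theorems.CylinderEntropyCylinderRungTwoProductTestLimit
import Summits.SmoothPoincare4.SmoothPoincare4.Theorems.CylinderEntropyCylinderRungTwoEquidistribution
import Summits.SmoothPoincare4.SmoothPoincare4.Theorems.CylinderEntropyCylinderRungTwoProductIdentification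
import Summits.SmoothPoincare4.SmoothPoincare4.Theorems.CylinderEntropyCylinderRungTwoDensityOfProductMeasure
import Summits.SmoothPoincare4.SmoothPoincare4.Theorems.CylinderEntropyCylinderRungTwoAtomicQuantization
import HarnessLib

/-!
# Route `CylinderEntropy`, crux `CylinderRungTwo` (stmt-SmoothPoincare4-7631), line `killing-flux`:
# AREA QUANTIZATION modulo Allard's integrality of limits (lead c2, reshape r10)

The flow-free GMT core `stub_areaQuantization` of the immortal half of the line (lead C reshape r7: almost-stationary,
slab-confined, end-separating embedded cross-sections `ι_k : M → N = S⁴ × ℝ ⊂ ℝ⁶` with `∫ H_k² → 0` and areas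
`μH⁴(range ι_k) → A < ⊤` have `A ∈ ℕ · μH⁴(S⁴)`) is PROVED here MODULO ONE PUBLISHED FACT, stated without varifolds:
ALLARD'S INTEGRALITY OF LIMITS (W. K. Allard, *On the first variation of a varifold*, Ann. of Math. 95 (1972),
Thm. 6.4 with §3.5; L. Simon, *Lectures on GMT*, Thm. 42.7/Rem. 42.8, §38) — weak limits of the area measures of such
cross-sections (bounded area, bounded total mean curvature) have POSITIVE INTEGER `4`-density almost everywhere — carried
as the hypothesis of the registered helper `helper_areaQuantizationOfAllard` (its registered open counterpart in the
skeleton is `stub_allardIntegralDensity`).  Everything else is kernel-checked, in eleven landed helper files: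

* S0 `helper_firstVariationBound` (Cauchy–Schwarz `∫|H| ≤ √area √∫H²`), S1 `helper_limitMeasureExists` (sequential
  Prokhorov on the compact slab), S2 `helper_productTestLimit` (the Green identities for the product test functions
  `Φ(z₅) P(z')` pass to the weak limit: `∫ Φ(z₅) Δ_{S⁴}P(z') dμ = 0`, from `helper_productTestIdentity` and
  `helper_tiltExcessVanishing`), S4 `helper_equidistribution` (such a `μ` is uniform in the `S⁴` factor — the heat
  semigroup of `S⁴` built from the typed zonal kernel: `helper_heatSmoothing{ContDiff,TimeDeriv,LargeTime,SmallTime}`,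
  `helper_zonalMassAndFirstMoment`), S7 `helper_densityOfProduct` (= `helper_productIdentification` ∘
  `helper_densityOfProductMeasure` ∘ `helper_smallCapAsymptotics`: the density of `vol_{S⁴} ⊗ σ` at `(q, c)` is
  `σ({c})/μH⁴(S⁴)`), S8 `helper_atomicQuantization` (integer densities force finitely many atoms of weight in
  `ℕ · μH⁴(S⁴)`).

So the residual analytic debt of the immortal half of `killing-flux` is EXACTLY Allard 1972 Thm 6.4 (+ the density of
integral varifolds), as the residual debt of path A is exactly White 2005 Thm 3.1 + §4 (`…EpsilonRegularityOfWhite.lean`).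
No `sorry`, no definitions, no named facts are introduced here (the Allard statement is a hypothesis, inlined).
-/

noncomputable section

set_option linter.dupNamespace false

open MeasureTheory Set Filter
open scoped Manifold ContDiff ENNReal NNReal Topology BigOperators

namespace Summit.SmoothPoincare4.SmoothPoincare4.Cruxes.CylinderRungTwo.KillingFlux

open Literature.Geometry.Riemannian
open Literature.Geometry.Lorentzian Literature.Geometry.Lorentzian.PseudoRiemannianMetric
open Literature.Geometry.Riemannian.SphericalCylinderEntropy (truncL zonal)

/-- **Registered helper `helper_densityOfProduct` (plan S7 = S7a ∘ S7b).**  For a finite measure on `ℝ⁶` carried by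
`N` and uniform in the `S⁴` factor against continuous test functions, the `4`-density at every `x ∈ N` exists and equals
`μ(N ∩ {z₅ = x₅}) / μH⁴(S⁴)` (`helper_productIdentification`: `μ` pushes forward to `(μH⁴(S⁴))⁻¹ μH⁴⌊S⁴ ⊗ (z₅)_# μ`;
`helper_densityOfProductMeasure`: densities of that product via the small-cap asymptotics). [folklore] -/
theorem helper_densityOfProduct : ∀ (μ : Measure (EuclideanSpace ℝ (Fin 6))) [IsFiniteMeasure μ], μ {z : EuclideanSpace ℝ (Fin 6) | ¬ (∑ i : Fin 5, z (Fin.castSucc i) ^ 2 = 1)} = 0 → (∀ Φ : ℝ → ℝ, Continuous Φ → ∀ g : EuclideanSpace ℝ (Fin 5) → ℝ, Continuous g → ∫ z, Φ (z 5) * g (truncL z) ∂μ = ((μH[4] (Metric.sphere (0 : EuclideanSpace ℝ (Fin 5)) 1)).toReal)⁻¹ * (∫ y in Metric.sphere (0 : EuclideanSpace ℝ (Fin 5)) 1, g y ∂(μH[4] : Measure (EuclideanSpace ℝ (Fin 5)))) * ∫ z, Φ (z 5) ∂μ) → ∀ x : EuclideanSpace ℝ (Fin 6), ∑ i : Fin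 5, x (Fin.castSucc i) ^ 2 = 1 → Filter.Tendsto (fun r : ℝ => μ (Metric.ball x r) / μH[4] (Metric.ball (0 : EuclideanSpace ℝ (Fin 4)) r)) (𝓝[>] 0) (𝓝 (μ {z : EuclideanSpace ℝ (Fin 6) | z 5 = x 5} / μH[4] (Metric.sphere (0 : EuclideanSpace ℝ (Fin 5)) 1))) :=
  fun μ _ hN hprod x hx => helper_densityOfProductMeasure μ hN (helper_productIdentification μ hN hprod) x hx

/-- **Registered helper `helper_areaQuantizationOfAllard`: AREA QUANTIZATION from Allard's integrality of limits.**
Given the (inlined) Allard fact, the registered signature of `stub_areaQuantization` follows: pass to a tail where areas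
are `≤ A + 1` and energies `≤ 1`; extract a weak limit `μ` of the area measures with `μ(ℝ⁶) = A`, carried by the slab
(S1); the product-test identities pass to the limit (S2), so `μ` is uniform in the `S⁴` factor (S4) and its density at
every point of `N` is `μ(slice)/μH⁴(S⁴)` (S7); by Allard (with the first-variation bound S0, `∫|H_k| ≤ A + 1`) the
density is a positive integer a.e., so the height marginal is finitely atomic with weights in `ℕ · μH⁴(S⁴)` (S8):
`A = μ(ℝ⁶) = m · μH⁴(S⁴)`. [cite: Allard1972, Thm. 6.4 and 3.5] -/
theorem helper_areaQuantizationOfAllard : (∀ (M : Type) [TopologicalSpace M] [T2Space M] [SecondCountableTopology M] [ChartedSpace (EuclideanSpace ℝ (Fin 4)) M] [IsManifold (𝓡 4) ∞ M] [CompactSpace M] [MeasurableSpace M] [BorelSpace M] (ι : ℕ → M → EuclideanSpace ℝ (Fin 6)) (ν : ℕ → M → EuclideanSpace ℝ (Fin 6)), (∀ k, Manifold.IsSmoothEmbedding (𝓡 4) (𝓡 6) ∞ (ι k)) → (∀ k x, ∑ i : Fin 5, ι k x (Fin.castSucc i) ^ 2 = 1) → ∀ himm : ∀ k, (euclideanMetric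 (EuclideanSpace ℝ (Fin 6))).IsSpacelikeImmersion (𝓡 4) (ι k), (∀ k, (euclideanMetric (EuclideanSpace ℝ (Fin 6))).IsUnitNormal (𝓡 4) (ι k) (ν k) 1) → (∀ k x, ∑ i : Fin 5, ν k x (Fin.castSucc i) * ι k x (Fin.castSucc i) = 0) → (∀ k, ContMDiff (𝓡 4) (𝓡 6) ∞ (ν k)) → ∀ C : ℝ≥0∞, C < ⊤ → (∀ k, μH[4] (Set.range (ι k)) ≤ C) → (∀ k, ∫⁻ x, ENNReal.ofReal |(euclideanMetric (EuclideanSpace ℝ (Fin 6))).meanCurvature (ι k) contMDiff_pullbackBilin_holds (himm k) (ν k) x| ∂(Measure.comap (ι k) (μH[4] : Measure (EuclideanSpace ℝ (Fin 6)))) ≤ C) → ∀ (μ : Measure (EuclideanSpace ℝ (Fin 6))) [IsFiniteMeasure μ], (∀ g : BoundedContinuousFunction (EuclideanSpace ℝ (Fin 6)) ℝ, Filter.Tendsto (fun k => ∫ z in Set.range (ι k), g z ∂(μH[4] : Measure (EuclideanSpace ℝ (Fin 6)))) Filter.atTop (𝓝 (∫ z, g z ∂μ))) → ∀ᵐ x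 ∂μ, ∃ N : ℕ, 0 < N ∧ Filter.Tendsto (fun r : ℝ => μ (Metric.ball x r) / μH[4] (Metric.ball (0 : EuclideanSpace ℝ (Fin 4)) r)) (𝓝[>] 0) (𝓝 (N : ℝ≥0∞))) → ∀ (M : Type) [TopologicalSpace M] [T2Space M] [SecondCountableTopology M] [ChartedSpace (EuclideanSpace ℝ (Fin 4)) M] [IsManifold (𝓡 4) ∞ M] [CompactSpace M] [ConnectedSpace M] [MeasurableSpace M] [BorelSpace M] (ι : ℕ → M → EuclideanSpace ℝ (Fin 6)) (ν : ℕ → M → EuclideanSpace ℝ (Fin 6)), (∀ k, Manifold.IsSmoothEmbedding (𝓡 4) (𝓡 6) ∞ (ι k)) → (∀ k x, ∑ i : Fin 5, ι k x (Fin.castSucc i) ^ 2 = 1) → (∀ k, SeparatesEnds (Set.range (ι k))) → ∀ himm : ∀ k, (euclideanMetric (EuclideanSpace ℝ (Fin 6))).IsSpacelikeImmersion (𝓡 4) (ι k), (∀ k, (euclideanMetric (EuclideanSpace ℝ (Fin 6))).IsUnitNormal (𝓡 4) (ι k) (ν k) 1) → (∀ k x, ∑ i : Fin 5, ν k x (Fin.castSucc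 i) * ι k x (Fin.castSucc i) = 0) → (∀ k, ContMDiff (𝓡 4) (𝓡 6) ∞ (ν k)) → ∀ B : ℝ, (∀ k x, |ι k x 5| ≤ B) → Filter.Tendsto (fun k => ∫⁻ x, ENNReal.ofReal ((euclideanMetric (EuclideanSpace ℝ (Fin 6))).meanCurvature (ι k) contMDiff_pullbackBilin_holds (himm k) (ν k) x ^ 2) ∂(Measure.comap (ι k) (μH[4] : Measure (EuclideanSpace ℝ (Fin 6))))) Filter.atTop (𝓝 0) → ∀ A : ℝ≥0∞, A < ⊤ → Filter.Tendsto (fun k => μH[4] (Set.range (ι k))) Filter.atTop (𝓝 A) → ∃ m : ℕ, A = m * μH[4] (Metric.sphere (0 : EuclideanSpace ℝ (Fin 5)) 1) := by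
  intro hF M _ _ _ _ _ _ _ _ _ ι ν hemb hN _hsep himm hun hνN hνs B hB hH A hA harea
  -- Step 0: pass to a tail on which the areas are `≤ A + 1` and the energies `≤ 1`
  have hev₁ : ∀ᶠ k in atTop, μH[4] (Set.range (ι k)) ≤ A + 1 := by
    have hlt : A < A + 1 := ENNReal.lt_add_right hA.ne one_ne_zero
    exact ((tendsto_order.1 harea).2 _ hlt).mono fun k hk => hk.le
  have hev₂ : ∀ᶠ k in atTop, ∫⁻ x, ENNReal.ofReal
      ((euclideanMetric (EuclideanSpace ℝ (Fin 6))).meanCurvature (ι k) contMDiff_pullbackBilin_holds (himm k)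
        (ν k) x ^ 2) ∂(Measure.comap (ι k) (μH[4] : Measure (EuclideanSpace ℝ (Fin 6)))) ≤ 1 :=
    ((tendsto_order.1 hH).2 1 one_pos).mono fun k hk => hk.le
  obtain ⟨k₀, hk₀⟩ := (hev₁.and hev₂).exists_forall_of_atTop
  -- the shifted sequence
  set ι' : ℕ → M → EuclideanSpace ℝ (Fin 6) := fun k => ι (k + k₀) with hι'
  set ν' : ℕ → M → EuclideanSpace ℝ (Fin 6) := fun k => ν (k + k₀) with hν'
  have himm' : ∀ k, (euclideanMetric (EuclideanSpace ℝ (Fin 6))).IsSpacelikeImmersion (𝓡 4) (ι' k) :=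
    fun k => himm (k + k₀)
  have hshift : Tendsto (fun k : ℕ => k + k₀) atTop atTop := tendsto_add_atTop_nat k₀
  have harea' : Tendsto (fun k => μH[4] (Set.range (ι' k))) atTop (𝓝 A) := harea.comp hshift
  have hH' : Tendsto (fun k => ∫⁻ x, ENNReal.ofReal
      ((euclideanMetric (EuclideanSpace ℝ (Fin 6))).meanCurvature (ι' k) contMDiff_pullbackBilin_holds (himm' k)
        (ν' k) x ^ 2) ∂(Measure.comap (ι' k) (μH[4] : Measure (EuclideanSpace ℝ (Fin 6))))) atTop (𝓝 0) :=
    hH.comp hshift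
  have hbd₁ : ∀ k, μH[4] (Set.range (ι' k)) ≤ A + 1 := fun k => (hk₀ (k + k₀) (Nat.le_add_left _ _)).1
  have hbd₂ : ∀ k, ∫⁻ x, ENNReal.ofReal
      ((euclideanMetric (EuclideanSpace ℝ (Fin 6))).meanCurvature (ι' k) contMDiff_pullbackBilin_holds (himm' k)
        (ν' k) x ^ 2) ∂(Measure.comap (ι' k) (μH[4] : Measure (EuclideanSpace ℝ (Fin 6)))) ≤ 1 :=
    fun k => (hk₀ (k + k₀) (Nat.le_add_left _ _)).2
  -- Step 1: a weak limit `μ` along a subsequence `φ`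
  obtain ⟨φ, hφ, μ, hμfin, hmass, hsupp, hweak⟩ :=
    helper_limitMeasureExists M ι' (fun k => hemb _) (fun k x => hN _ x) B (fun k x => hB _ x) A hA hbd₁ harea'
  haveI := hμfin
  -- the subsequence data
  set ι'' : ℕ → M → EuclideanSpace ℝ (Fin 6) := fun k => ι' (φ k) with hι''
  set ν'' : ℕ → M → EuclideanSpace ℝ (Fin 6) := fun k => ν' (φ k) with hν''
  have himm'' : ∀ k, (euclideanMetric (EuclideanSpace ℝ (Fin 6))).IsSpacelikeImmersion (𝓡 4) (ι'' k) :=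
    fun k => himm' (φ k)
  have hφt : Tendsto φ atTop atTop := hφ.tendsto_atTop
  -- Step 2: the product-test identities hold in the limit
  have hprod := helper_productTestLimit M ι'' ν'' (fun k => hemb _) (fun k x => hN _ x) himm'' (fun k => hun _) (fun k x => hνN _ x)
    (fun k => hνs _) B (fun k x => hB _ x) (hH'.comp hφt) A hA (harea'.comp hφt) μ hsupp hweak
  -- Step 3: equidistribution, Step 4: densities everywhere on `N`
  have hsuppN : μ {z : EuclideanSpace ℝ (Fin 6) | ¬ (∑ i : Fin 5, z (Fin.castSucc i) ^ 2 = 1)} = 0 := by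
    refine measure_mono_null (fun z hz => ?_) hsupp
    simp only [Set.mem_setOf_eq] at hz ⊢
    exact fun h => hz h.1
  have hequi := helper_equidistribution B μ hsupp hprod
  have hdens := helper_densityOfProduct μ hsuppN hequi
  -- Step 5: Allard — the density is a positive integer a.e.
  have hC : ∀ k, ∫⁻ x, ENNReal.ofReal
      |(euclideanMetric (EuclideanSpace ℝ (Fin 6))).meanCurvature (ι'' k) contMDiff_pullbackBilin_holds (himm'' k)
        (ν'' k) x| ∂(Measure.comap (ι'' k) (μH[4] : Measure (EuclideanSpace ℝ (Fin 6)))) ≤ A + 1 := by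
    intro k
    refine (helper_firstVariationBound M (ι'' k) (ν'' k) (hemb _) (himm'' k) (hνs _)).trans ?_
    have h1 : (μH[4] (Set.range (ι'' k))) ^ (1 / 2 : ℝ) ≤ (A + 1) ^ (1 / 2 : ℝ) :=
      ENNReal.rpow_le_rpow (hbd₁ (φ k)) (by norm_num)
    have h2 : (∫⁻ x, ENNReal.ofReal
        ((euclideanMetric (EuclideanSpace ℝ (Fin 6))).meanCurvature (ι'' k) contMDiff_pullbackBilin_holds (himm'' k)
          (ν'' k) x ^ 2) ∂(Measure.comap (ι'' k) (μH[4] : Measure (EuclideanSpace ℝ (Fin 6))))) ^ (1 / 2 : ℝ) ≤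
        (A + 1) ^ (1 / 2 : ℝ) := by
      refine ENNReal.rpow_le_rpow ((hbd₂ (φ k)).trans ?_) (by norm_num)
      exact le_add_self
    calc _ ≤ (A + 1) ^ (1 / 2 : ℝ) * (A + 1) ^ (1 / 2 : ℝ) := mul_le_mul' h1 h2
      _ = A + 1 := by
          rw [← ENNReal.rpow_add_of_nonneg _ _ (by norm_num) (by norm_num)]
          norm_num
  have hint := hF M ι'' ν'' (fun k => hemb _) (fun k x => hN _ x) himm'' (fun k => hun _) (fun k x => hνN _ x)
    (fun k => hνs _) (A + 1) (ENNReal.add_lt_top.2 ⟨hA, ENNReal.one_lt_top⟩) (fun k => hbd₁ (φ k)) hC μ hweak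
  -- Step 6: atomic quantization
  obtain ⟨m, hm⟩ := helper_atomicQuantization μ hsuppN hdens hint
  exact ⟨m, by rw [← hmass, hm]⟩

end Summit.SmoothPoincare4.SmoothPoincare4.Cruxes.CylinderRungTwo.KillingFlux

end
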